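import Summits.QuantumFields.YangMills.Theorems.BalabanUVNodesN18TwoBlockLoopStokes
import Literature.MathematicalPhysics.QuantumFieldTheory.Balaban1983to89.B7Prop7OneStep
import HarnessLib

/-!
# N18 (β)-transport letters: the axial-gauge box Stokes in the GROWTH currency `‖V(b)‖, ‖V(b)⁻¹‖ ≤ K`

[DAGN18W3-G4 INTENT-7, file (7a)] — count-neutral helper toward K3⁷ `stmt-QuantumFields-20544` (NOT claimed, NOT closed).  YM mass gap (Clay) NOT proved by
any of this; R4 closes the conditional finite-𝕋⁴ rung `BalabanLadder.UV` only.

WHY.  The plaquette letter of the COMPLEX averaged field `Ū(𝐔)` ([Balaban1987RG1] (1.14) one scale up = [Balaban1985Averaging] Prop. 1 (51) for `Gᶜ`-valued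
fields) needs the (0.4) loop variables and the side-`L` squares of `𝐔 = (exp iηA′)U ∈ SL(N, ℂ)` bounded from its plaquettes (1.14); the tree's box Stokes
(`B7Prop1Explicit` §2, p615425 ∕ p617643) lives in `U1 = {‖u‖ ≤ 1, ‖u⁻¹‖ ≤ 1}`, which `𝐔` leaves.  This file redoes ONLY THE NORM LEMMAS of that mechanism for
`‖V(b)‖, ‖V(b)⁻¹‖ ≤ K` (`K ≥ 1`), tracking the growth `K^{(·)}` explicitly (all identities — `hol_ladder_cons`, `hol_gaugeAct`, `axialFn`, the tree-gauge identity —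
are the tree's); `K = 1` recovers p615425 §1 to first order.  Mechanism: `‖V_x(w)^{±1}‖ ≤ K^{|w|}`; `‖uXu⁻¹ − 1‖ ≤ ‖u‖‖X − 1‖‖u⁻¹‖`; a backward elementary loop is
a bond-conjugated inverse plaquette (`≤ K⁶α`); the LADDER bound is proved for `V` itself (conjugator of the recursion = one bond, `K²` per rung):
`|Q|·α′·(K²(1+α′))^{|Q|}`; `axial_bond_eq` is re-exported with its base point, whence `V₀(x, x+e_μ) = v₀(x)[V_w(Q)⁻¹V_w(ladder Q)V_w(Q)]v₀(x)⁻¹` and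
`‖V₀(b) − 1‖ ≤ K^{4n}·n·α′·(K²(1+α′))ⁿ`, `n = |b₋ − y|₁`; a closed word from `y` is the product of its `V₀`-steps (backward steps cost `‖V₀(b)⁻¹‖ ≤ K^{2R+1}`), and
`‖Πxᵢ − 1‖ ≤ (1+β)ⁿ − 1`.

CONTENTS (namespace `YMDAG.N18.BoxStokes`, `ℤᵈ`, any normed ring with `‖1‖ = 1`): §1 bookkeeping (`norm_stepHol_le_growth`, `norm_mul_sub_one_le_pow_growth`, `disp_ladder`; the tree's `B7Prop7OneStep.norm_hol_le_pow` ∕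
`norm_units_conj_sub_one_le_mul` BY NAME; `‖u⁻¹ − 1‖ ≤ ‖u⁻¹‖‖u − 1‖` inline as in `B9Thm310CommutatorDataOfPlaquettes.norm_inv_sub_one_le_mul`); §2 `norm_hol_lplaqWord_sub_one_le_growth`,
★ `norm_hol_ladder_sub_one_le_growth`, `axial_bond_eq_base`, `norm_axialFn_le_growth`, ★★ `axial_bond_bound_growth`, `norm_gaugeAct_axialFn_inv_le_growth`;
§3 `norm_hol_sub_one_le_pow_of_steps`, ★★★ `norm_hol_closed_sub_one_le_of_radius_growth`, `clampCfg_growth`, ★★★ `norm_hol_closed_sub_one_le_inBox_growth`.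
0 `def`, 0 `sorry`.  References: T. Bałaban, CMP **98** (1985) 17–51 [Balaban1985Averaging] ((9) p.18, (19)–(20) p.21, (44) p.24, pp.24–25); CMP **109** (1987)
249–301 [Balaban1987RG1] ((0.4) p.253, (1.14) p.262).
-/

noncomputable section

open scoped BigOperators

namespace YMDAG.N18.BoxStokes

open Literature.MathematicalPhysics.QuantumFieldTheory.Balaban1983to89
open Literature.MathematicalPhysics.QuantumFieldTheory.Balaban1983to89.B7Prop1Explicit renaming Site → LSite
open Literature.MathematicalPhysics.QuantumFieldTheory.Balaban1983to89.B7Prop1Explicit (Letter e e_apply disp disp_cons disp_nil disp_append disp_revWord hol hol_cons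
  hol_nil hol_append stepHol stepHol_true stepHol_false l1 l1_add_le l1_disp_le gaugeAct axialFn hol_gaugeAct hol_gaugeAct_closed plaqWord lplaqWord ladder hol_ladder_cons
  treeWord treeWord_zero length_treeWord disp_treeWord seg disp_seg hol_seg_succ mem_seg flatMap_congr_of hol_axial_treeWord revWord length_revWord hol_revWord)
open Literature.MathematicalPhysics.QuantumFieldTheory.Balaban1983to89.B7Prop1Local (InBox PlaqIn AgreeOn clampCfg clampCfg_agree clamp clamp_inBox clamp_add_e_of
  norm_hol_plaqWord_clampCfg_le add_e_apply)
open Literature.MathematicalPhysics.QuantumFieldTheory.Balaban1983to89.B7Prop7OneStep (norm_units_conj_sub_one_le_mul norm_hol_le_pow)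

variable {d : ℕ} {𝔸 : Type*} [NormedRing 𝔸] [NormOneClass 𝔸]

/-! ## §1 Growth bookkeeping -/

section Bookkeeping

omit [NormOneClass 𝔸] in
/-- One step of transport is a bond variable or its inverse: both are bounded by `K` when all bond variables and their inverses are. [cite: Balaban1985Averaging, (9) p.18] -/
theorem norm_stepHol_le_growth {V : LSite d → Fin d → 𝔸ˣ} {K : ℝ} (hK : ∀ x κ, ‖((V x κ : 𝔸ˣ) : 𝔸)‖ ≤ K ∧ ‖(((V x κ)⁻¹ : 𝔸ˣ) : 𝔸)‖ ≤ K)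
    (x : LSite d) (l : Letter d) : ‖((stepHol V x l : 𝔸ˣ) : 𝔸)‖ ≤ K ∧ ‖(((stepHol V x l)⁻¹ : 𝔸ˣ) : 𝔸)‖ ≤ K := by
  unfold stepHol; split_ifs
  · exact hK _ _
  · rw [inv_inv]; exact ⟨(hK _ _).2, (hK _ _).1⟩

/-- **Products near `1`**: `‖a − 1‖ ≤ β`, `‖b − 1‖ ≤ (1+β)ⁿ − 1`, `0 ≤ β` ⇒ `‖ab − 1‖ ≤ (1+β)ⁿ⁺¹ − 1` (`ab − 1 = (a − 1)b + (b − 1)`, `‖b‖ ≤ (1+β)ⁿ`). [folklore] -/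
theorem norm_mul_sub_one_le_pow_growth {a b : 𝔸} {β : ℝ} {n : ℕ} (hβ : 0 ≤ β) (ha : ‖a - 1‖ ≤ β) (hb : ‖b - 1‖ ≤ (1 + β) ^ n - 1) :
    ‖a * b - 1‖ ≤ (1 + β) ^ (n + 1) - 1 := by
  have hb' : ‖b‖ ≤ (1 + β) ^ n := by have := norm_le_norm_add_norm_sub' b 1; rw [norm_one] at this; linarith
  have h : a * b - 1 = (a - 1) * b + (b - 1) := by noncomm_ring
  rw [h, pow_succ]
  calc _ ≤ ‖(a - 1) * b‖ + ‖b - 1‖ := norm_add_le _ _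
    _ ≤ β * (1 + β) ^ n + ((1 + β) ^ n - 1) :=
        add_le_add ((norm_mul_le _ _).trans (mul_le_mul ha hb' (norm_nonneg _) hβ)) hb
    _ = _ := by ring

/-- The ladder loop is closed. [folklore] -/
theorem disp_ladder (w : List (Letter d)) (μ : Fin d) : disp (ladder w μ) = 0 := by
  simp only [ladder, disp_append, disp_cons, disp_nil, disp_revWord, Letter.vec_true, Letter.vec_false, add_zero]
  abel

end Bookkeeping

/-! ## §2 Elementary loops, ladders and the axial gauge with growth -/

section Axial

/-- **The elementary loop of a letter, with growth**: if the plaquette contours `∂p` (all base points, both orientations) satisfy `‖V(∂p) − 1‖ ≤ α` and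
`‖V(b)‖, ‖V(b)⁻¹‖ ≤ K` (`K ≥ 1`), then the elementary loop spanned by any letter `l` with `l.1 ≠ μ` and `e_μ` is within `K⁶α` of `1` — for a backward letter
it is a bond-conjugated inverse plaquette (`‖P⁻¹ − 1‖ ≤ ‖P⁻¹‖·‖P − 1‖ ≤ K⁴α`, conjugation `K²`). [cite: Balaban1985Averaging, (44) p.24 and pp.24-25] -/
theorem norm_hol_lplaqWord_sub_one_le_growth {V : LSite d → Fin d → 𝔸ˣ} {K : ℝ}
    (hK : ∀ x κ, ‖((V x κ : 𝔸ˣ) : 𝔸)‖ ≤ K ∧ ‖(((V x κ)⁻¹ : 𝔸ˣ) : 𝔸)‖ ≤ K) (hK1 : 1 ≤ K) {α : ℝ} (hα : 0 ≤ α)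
    (h44 : ∀ (x : LSite d) (κ μ : Fin d), κ ≠ μ → ‖((hol V x (plaqWord κ μ) : 𝔸ˣ) : 𝔸) - 1‖ ≤ α)
    (x : LSite d) (l : Letter d) (μ : Fin d) (hl : l.1 ≠ μ) :
    ‖((hol V x (lplaqWord l μ) : 𝔸ˣ) : 𝔸) - 1‖ ≤ K ^ 6 * α := by
  have hK0 : 0 ≤ K := zero_le_one.trans hK1
  obtain ⟨κ, b⟩ := l
  cases b
  · -- backward letter: conjugated inverse plaquette at `x - e κ`
    have hid : hol V x (lplaqWord (κ, false) μ) = (V (x - e κ) κ)⁻¹ * (hol V (x - e κ) (plaqWord κ μ))⁻¹ * V (x - e κ) κ := by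
      simp only [lplaqWord, plaqWord, hol_cons, hol_nil, mul_one, stepHol_true, stepHol_false, Letter.rev_mk, Bool.not_false, Letter.vec_true,
        Letter.vec_false, mul_inv_rev, inv_inv]
      abel_nf; group
    have hP4 : ‖(((hol V (x - e κ) (plaqWord κ μ))⁻¹ : 𝔸ˣ) : 𝔸)‖ ≤ K ^ 4 :=
      (norm_hol_le_pow hK0 hK (plaqWord κ μ) (x - e κ)).2
    set P := hol V (x - e κ) (plaqWord κ μ) with hP
    have hPinv : ‖((P⁻¹ : 𝔸ˣ) : 𝔸) - 1‖ ≤ K ^ 4 * α := by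
      have h1 : ‖((P⁻¹ : 𝔸ˣ) : 𝔸) - 1‖ ≤ ‖((P⁻¹ : 𝔸ˣ) : 𝔸)‖ * ‖(P : 𝔸) - 1‖ := by
        rw [show ((P⁻¹ : 𝔸ˣ) : 𝔸) - 1 = ((P⁻¹ : 𝔸ˣ) : 𝔸) * (1 - (P : 𝔸)) by rw [mul_sub, mul_one, Units.inv_mul], ← norm_sub_rev (1 : 𝔸) (P : 𝔸)]
        exact norm_mul_le _ _
      exact h1.trans (mul_le_mul hP4 (h44 _ κ μ hl) (norm_nonneg _) (pow_nonneg hK0 4))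
    rw [hid, Units.val_mul, Units.val_mul]
    have hc := norm_units_conj_sub_one_le_mul (V (x - e κ) κ)⁻¹ ((P⁻¹ : 𝔸ˣ) : 𝔸)
    rw [inv_inv] at hc
    refine hc.trans ?_
    calc _ ≤ K * (K ^ 4 * α) * K := by
          refine mul_le_mul (mul_le_mul (hK _ _).2 hPinv (norm_nonneg _) hK0) (hK _ _).1 (norm_nonneg _) ?_
          exact mul_nonneg hK0 (mul_nonneg (pow_nonneg hK0 4) hα)
      _ = K ^ 6 * α := by ring
  · rw [B7Prop1Explicit.lplaqWord_true]
    refine (h44 x κ μ hl).trans ?_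
    have : (1 : ℝ) ≤ K ^ 6 := one_le_pow₀ hK1
    nlinarith

/-- ★ **THE LADDER BOUND WITH GROWTH** (for `V` itself; the conjugator of the recursion `hol_ladder_cons` is ONE bond variable, cost `K²` per rung): if every elementary
loop spanned by a letter `κ ≠ μ` and `e_μ` is within `α′` of `1` and `‖V(b)‖, ‖V(b)⁻¹‖ ≤ K`, then for every word `Q` without `e_μ`-letters
`‖V_x(ladder Q) − 1‖ ≤ |Q|·α′·(K²(1+α′))^{|Q|}`. [cite: Balaban1985Averaging, pp.24-25] -/
theorem norm_hol_ladder_sub_one_le_growth {V : LSite d → Fin d → 𝔸ˣ} {K : ℝ}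
    (hK : ∀ x κ, ‖((V x κ : 𝔸ˣ) : 𝔸)‖ ≤ K ∧ ‖(((V x κ)⁻¹ : 𝔸ˣ) : 𝔸)‖ ≤ K) (hK1 : 1 ≤ K) (μ : Fin d) {α' : ℝ} (hα' : 0 ≤ α')
    (hP : ∀ (x : LSite d) (l : Letter d), l.1 ≠ μ → ‖((hol V x (lplaqWord l μ) : 𝔸ˣ) : 𝔸) - 1‖ ≤ α') :
    ∀ (Q : List (Letter d)) (x : LSite d), (∀ l ∈ Q, l.1 ≠ μ) →
      ‖((hol V x (ladder Q μ) : 𝔸ˣ) : 𝔸) - 1‖ ≤ Q.length * α' * (K ^ 2 * (1 + α')) ^ Q.length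
  | [], x, _ => by simp [ladder, stepHol_true, stepHol_false]
  | l :: Q, x, hQ => by
    have hK0 : 0 ≤ K := zero_le_one.trans hK1
    have hM1 : 1 ≤ K ^ 2 * (1 + α') := by nlinarith [one_le_pow₀ (n := 2) hK1]
    have ih := norm_hol_ladder_sub_one_le_growth hK hK1 μ hα' hP Q (x + l.vec) fun l' hl' => hQ l' (List.mem_cons_of_mem l hl')
    have hl := hP x l (hQ l (by simp))
    obtain ⟨hg1, hg2⟩ := norm_stepHol_le_growth hK x l
    rw [hol_ladder_cons, Units.val_mul, List.length_cons, Nat.cast_succ]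
    set A : 𝔸 := ((stepHol V x l * hol V (x + l.vec) (ladder Q μ) * (stepHol V x l)⁻¹ : 𝔸ˣ) : 𝔸) with hA
    set B : 𝔸 := ((hol V x (lplaqWord l μ) : 𝔸ˣ) : 𝔸) with hB
    set n := Q.length with hn
    set M := K ^ 2 * (1 + α') with hM
    have hA1 : ‖A - 1‖ ≤ K * (n * α' * M ^ n) * K := by
      rw [hA, Units.val_mul, Units.val_mul]
      exact (norm_units_conj_sub_one_le_mul _ _).trans (mul_le_mul (mul_le_mul hg1 ih (norm_nonneg _) hK0) hg2 (norm_nonneg _)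
        (mul_nonneg hK0 (mul_nonneg (mul_nonneg (Nat.cast_nonneg _) hα') (pow_nonneg (zero_le_one.trans hM1) _))))
    have hBn : ‖B‖ ≤ 1 + α' := by have := norm_le_norm_add_norm_sub' B 1; rw [norm_one] at this; linarith
    have hid : A * B - 1 = (A - 1) * B + (B - 1) := by noncomm_ring
    rw [hid]
    have hMn : 0 ≤ M ^ n := pow_nonneg (zero_le_one.trans hM1) _
    calc _ ≤ ‖(A - 1) * B‖ + ‖B - 1‖ := norm_add_le _ _
      _ ≤ K * (n * α' * M ^ n) * K * (1 + α') + α' :=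
          add_le_add ((norm_mul_le _ _).trans (mul_le_mul hA1 hBn (norm_nonneg _) (by positivity))) hl
      _ = n * α' * M ^ (n + 1) + α' := by rw [hM]; ring
      _ ≤ n * α' * M ^ (n + 1) + α' * M ^ (n + 1) := by nlinarith [one_le_pow₀ (n := n + 1) hM1]
      _ = (n + 1) * α' * M ^ (n + 1) := by ring

/-- **The tree-gauge identity of p. 25 l. 3 with its base point** (`B7Prop1Explicit.axial_bond_eq`, re-exported with the extra bookkeeping `w + disp Q = x` its proof
contains): in the axial gauge `V₀` based at `y`, `V₀(x, x+e_μ) = V₀_w(Q)⁻¹·V₀_w(ladder Q)·V₀_w(Q)` for a sub-contour `Q` of `Γ_{y,x}` ending at `x`, without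
`e_μ`-letters, `|Q| ≤ |x − y|₁`. [cite: Balaban1985Averaging, pp.24-25] -/
theorem axial_bond_eq_base {G : Type*} [Group G] (V : LSite d → Fin d → G) (y x : LSite d) (μ : Fin d) :
    ∃ (w : LSite d) (Q : List (Letter d)), (∀ l ∈ Q, l.1 ≠ μ) ∧ Q.length ≤ l1 (x - y) ∧ w + disp Q = x ∧
      gaugeAct (axialFn V y) V x μ =
        (hol (gaugeAct (axialFn V y) V) w Q)⁻¹ * hol (gaugeAct (axialFn V y) V) w (ladder Q μ) * hol (gaugeAct (axialFn V y) V) w Q := by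
  obtain ⟨s, t, hst⟩ := List.append_of_mem (a := μ) (l := (List.finRange d).reverse) (by simp)
  have hnd : (s ++ μ :: t).Nodup := by rw [← hst]; exact List.nodup_reverse.mpr (List.nodup_finRange d)
  have hμst : μ ∉ s ++ t := (List.nodup_cons.mp (List.nodup_middle.mp hnd)).1
  rw [List.mem_append, not_or] at hμst
  set V₀ := gaugeAct (axialFn V y) V with hV₀
  set v : LSite d := x - y with hv
  let f : Fin d → List (Letter d) := fun κ => seg κ (v κ)
  have hne : ∀ κ, κ ≠ μ → seg κ ((v + e μ) κ) = f κ := fun κ hκ => by simp [f, e, hκ]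
  have hμμ : seg μ ((v + e μ) μ) = seg μ (v μ + 1) := by simp [e]
  have h1 : treeWord v = s.flatMap f ++ (seg μ (v μ) ++ t.flatMap f) := by rw [treeWord, hst, List.flatMap_append, List.flatMap_cons]
  have h2 : treeWord (v + e μ) = s.flatMap f ++ (seg μ (v μ + 1) ++ t.flatMap f) := by
    rw [treeWord, hst, List.flatMap_append, List.flatMap_cons, hμμ, flatMap_congr_of (s := s) (fun κ hκ => hne κ (fun h => hμst.1 (h ▸ hκ))),
      flatMap_congr_of (s := t) (fun κ hκ => hne κ (fun h => hμst.2 (h ▸ hκ)))]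
  have ht1 := hol_axial_treeWord V y v; have ht2 := hol_axial_treeWord V y (v + e μ); rw [← hV₀] at ht1 ht2
  rw [h1, hol_append, hol_append] at ht1
  rw [h2, hol_append, hol_append, hol_seg_succ, disp_seg, add_smul, one_smul, ← add_assoc] at ht2
  set z := y + disp (s.flatMap f) with hz; set w := z + v μ • e μ with hw; set Q := t.flatMap f with hQ
  rw [disp_seg] at ht1
  have hx : w + disp Q = x := by
    have := disp_treeWord v
    rw [h1, disp_append, disp_append, disp_seg] at this
    rw [hw, hz, add_assoc, add_assoc, this, hv, add_sub_cancel]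
  refine ⟨w, Q, ?_, ?_, hx, ?_⟩
  · intro l hl hlμ
    obtain ⟨κ, hκt, hlκ⟩ := List.mem_flatMap.mp hl
    exact hμst.2 (by rwa [← hlμ, mem_seg hlκ])
  · have hlen : (treeWord v).length = (s.flatMap f).length + ((seg μ (v μ)).length + Q.length) := by
      rw [h1, List.length_append, List.length_append]
    rw [length_treeWord] at hlen
    omega
  · have h3 : hol V₀ w Q = V₀ w μ * hol V₀ (w + e μ) Q := by
      have := ht1.trans ht2.symm; rw [mul_assoc] at this; exact mul_left_cancel (mul_left_cancel this)
    rw [B7Prop1Explicit.hol_ladder, hx, h3]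
    group

/-- The axial gauge transformation `v₀(x) = V(Γ_{y,x})` has `‖v₀(x)‖, ‖v₀(x)⁻¹‖ ≤ K^{|x − y|₁}`. [cite: Balaban1985Averaging, p.24] -/
theorem norm_axialFn_le_growth {V : LSite d → Fin d → 𝔸ˣ} {K : ℝ} (hK : ∀ x κ, ‖((V x κ : 𝔸ˣ) : 𝔸)‖ ≤ K ∧ ‖(((V x κ)⁻¹ : 𝔸ˣ) : 𝔸)‖ ≤ K)
    (hK1 : 1 ≤ K) (y x : LSite d) :
    ‖((axialFn V y x : 𝔸ˣ) : 𝔸)‖ ≤ K ^ l1 (x - y) ∧ ‖(((axialFn V y x)⁻¹ : 𝔸ˣ) : 𝔸)‖ ≤ K ^ l1 (x - y) := by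
  have := norm_hol_le_pow (zero_le_one.trans hK1) hK (treeWord (x - y)) y
  rwa [length_treeWord] at this

/-- ★★ **THE BOND BOUND IN THE AXIAL GAUGE, WITH GROWTH** ([Balaban1985Averaging] p. 25 l. 3 «|V₀,b − 1| < |b₋ − y|α₀» for norm-bounded, not necessarily unitary,
bond variables): if all plaquette contours are within `α` of `1` and `‖V(b)‖, ‖V(b)⁻¹‖ ≤ K` (`K ≥ 1`), then with `n = |x − y|₁`, `α′ = K⁶α`,
`‖V₀(x, x+e_μ) − 1‖ ≤ K^{4n}·(n·α′·(K²(1+α′))ⁿ)` — by `axial_bond_eq_base` and gauge covariance `V₀(x, x+e_μ) = v₀(x)·[V_w(Q)⁻¹·V_w(ladder Q)·V_w(Q)]·v₀(x)⁻¹`.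
[cite: Balaban1985Averaging, pp.24-25] -/
theorem axial_bond_bound_growth {V : LSite d → Fin d → 𝔸ˣ} {K : ℝ} (hK : ∀ x κ, ‖((V x κ : 𝔸ˣ) : 𝔸)‖ ≤ K ∧ ‖(((V x κ)⁻¹ : 𝔸ˣ) : 𝔸)‖ ≤ K)
    (hK1 : 1 ≤ K) (y : LSite d) {α : ℝ} (hα : 0 ≤ α)
    (h44 : ∀ (x : LSite d) (κ μ : Fin d), κ ≠ μ → ‖((hol V x (plaqWord κ μ) : 𝔸ˣ) : 𝔸) - 1‖ ≤ α) (x : LSite d) (μ : Fin d) :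
    ‖((gaugeAct (axialFn V y) V x μ : 𝔸ˣ) : 𝔸) - 1‖ ≤
      K ^ (4 * l1 (x - y)) * (l1 (x - y) * (K ^ 6 * α) * (K ^ 2 * (1 + K ^ 6 * α)) ^ l1 (x - y)) := by
  have hK0 : 0 ≤ K := zero_le_one.trans hK1
  set n := l1 (x - y) with hn
  set α' := K ^ 6 * α with hα'
  have hα'0 : 0 ≤ α' := mul_nonneg (pow_nonneg hK0 6) hα
  set M := K ^ 2 * (1 + α') with hM
  have hM1 : 1 ≤ M := by nlinarith [one_le_pow₀ (n := 2) hK1]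
  obtain ⟨w, Q, hQμ, hQn, hwx, hid⟩ := axial_bond_eq_base V y x μ
  rw [← hn] at hQn
  -- gauge covariance: everything in terms of `V`
  have hA := hol_gaugeAct (axialFn V y) V w Q
  have hL := hol_gaugeAct_closed (axialFn V y) V w (ladder Q μ) (disp_ladder Q μ)
  rw [hwx] at hA
  have hid' : gaugeAct (axialFn V y) V x μ =
      axialFn V y x * ((hol V w Q)⁻¹ * hol V w (ladder Q μ) * hol V w Q) * (axialFn V y x)⁻¹ := by
    rw [hid, hA, hL]; group
  -- the pieces
  have hlad : ‖((hol V w (ladder Q μ) : 𝔸ˣ) : 𝔸) - 1‖ ≤ n * α' * M ^ n := by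
    have h := norm_hol_ladder_sub_one_le_growth hK hK1 μ hα'0 (fun x' l hl => norm_hol_lplaqWord_sub_one_le_growth hK hK1 hα h44 x' l μ hl) Q w hQμ
    refine h.trans ?_
    have h1 : (Q.length : ℝ) ≤ n := by exact_mod_cast hQn
    have h2 : M ^ Q.length ≤ M ^ n := pow_le_pow_right₀ hM1 hQn
    have h3 : 0 ≤ M ^ Q.length := pow_nonneg (zero_le_one.trans hM1) _
    calc (Q.length : ℝ) * α' * M ^ Q.length ≤ n * α' * M ^ Q.length := by gcongr
      _ ≤ n * α' * M ^ n := by gcongr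
  obtain ⟨hH1, hH2⟩ := norm_hol_le_pow hK0 hK Q w
  obtain ⟨ha1, ha2⟩ := norm_axialFn_le_growth hK hK1 y x
  have hHn : K ^ Q.length ≤ K ^ n := pow_le_pow_right₀ hK1 hQn
  have hinner : ‖(((hol V w Q)⁻¹ * hol V w (ladder Q μ) * hol V w Q : 𝔸ˣ) : 𝔸) - 1‖ ≤ K ^ n * (n * α' * M ^ n) * K ^ n := by
    rw [Units.val_mul, Units.val_mul]
    have hc := norm_units_conj_sub_one_le_mul (hol V w Q)⁻¹ ((hol V w (ladder Q μ) : 𝔸ˣ) : 𝔸)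
    rw [inv_inv] at hc
    refine hc.trans (mul_le_mul (mul_le_mul (hH2.trans hHn) hlad (norm_nonneg _) (pow_nonneg hK0 _)) (hH1.trans hHn) (norm_nonneg _) ?_)
    exact mul_nonneg (pow_nonneg hK0 _) (mul_nonneg (mul_nonneg (Nat.cast_nonneg _) hα'0) (pow_nonneg (zero_le_one.trans hM1) _))
  rw [hid', Units.val_mul, Units.val_mul]
  refine (norm_units_conj_sub_one_le_mul _ _).trans ?_
  calc _ ≤ K ^ n * (K ^ n * (n * α' * M ^ n) * K ^ n) * K ^ n := by
        refine mul_le_mul (mul_le_mul ha1 hinner (norm_nonneg _) (pow_nonneg hK0 _)) ha2 (norm_nonneg _) ?_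
        exact mul_nonneg (pow_nonneg hK0 _) (mul_nonneg (mul_nonneg (pow_nonneg hK0 _)
          (mul_nonneg (mul_nonneg (Nat.cast_nonneg _) hα'0) (pow_nonneg (zero_le_one.trans hM1) _))) (pow_nonneg hK0 _))
    _ = K ^ (4 * n) * (n * α' * M ^ n) := by ring

/-- The axial-gauge bond variables have `‖V₀(z, z+e_κ)⁻¹‖ ≤ K^{|z + e_κ − y|₁ + 1 + |z − y|₁}` (`V₀(b) = v₀(b₋)V(b)v₀(b₊)⁻¹`). [cite: Balaban1985Averaging, p.24] -/
theorem norm_gaugeAct_axialFn_inv_le_growth {V : LSite d → Fin d → 𝔸ˣ} {K : ℝ}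
    (hK : ∀ x κ, ‖((V x κ : 𝔸ˣ) : 𝔸)‖ ≤ K ∧ ‖(((V x κ)⁻¹ : 𝔸ˣ) : 𝔸)‖ ≤ K) (hK1 : 1 ≤ K) (y z : LSite d) (κ : Fin d) :
    ‖(((gaugeAct (axialFn V y) V z κ)⁻¹ : 𝔸ˣ) : 𝔸)‖ ≤ K ^ (l1 (z + e κ - y) + 1 + l1 (z - y)) := by
  have hK0 : 0 ≤ K := zero_le_one.trans hK1
  obtain ⟨h1, -⟩ := norm_axialFn_le_growth hK hK1 y (z + e κ)
  obtain ⟨-, h2⟩ := norm_axialFn_le_growth hK hK1 y z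
  have hid : (((gaugeAct (axialFn V y) V z κ)⁻¹ : 𝔸ˣ) : 𝔸) =
      ((axialFn V y (z + e κ) : 𝔸ˣ) : 𝔸) * ((((V z κ)⁻¹ : 𝔸ˣ) : 𝔸) * (((axialFn V y z)⁻¹ : 𝔸ˣ) : 𝔸)) := by
    unfold gaugeAct
    rw [mul_inv_rev, mul_inv_rev, inv_inv, Units.val_mul, Units.val_mul]
  rw [hid, pow_add, pow_add, pow_one]
  calc _ ≤ ‖((axialFn V y (z + e κ) : 𝔸ˣ) : 𝔸)‖ * ‖(((V z κ)⁻¹ : 𝔸ˣ) : 𝔸) * (((axialFn V y z)⁻¹ : 𝔸ˣ) : 𝔸)‖ := norm_mul_le _ _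
    _ ≤ ‖((axialFn V y (z + e κ) : 𝔸ˣ) : 𝔸)‖ * (‖(((V z κ)⁻¹ : 𝔸ˣ) : 𝔸)‖ * ‖(((axialFn V y z)⁻¹ : 𝔸ˣ) : 𝔸)‖) := by
        gcongr; exact norm_mul_le _ _
    _ ≤ K ^ l1 (z + e κ - y) * (K * K ^ l1 (z - y)) :=
        mul_le_mul h1 (mul_le_mul (hK z κ).2 h2 (norm_nonneg _) hK0) (by positivity) (pow_nonneg hK0 _)
    _ = _ := by ring

end Axial

/-! ## §3 Closed words in a box, with growth -/

section Closed

/-- Transport along a word all of whose STEPS are within `γ` of `1`: `‖W_x(w) − 1‖ ≤ (1+γ)^{|w|} − 1` (the steps are read at the positions of the walk, which stay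
in the box `[lo, hi]`). [cite: Balaban1985Averaging, (9) p.18 and (19)-(20) p.21] -/
theorem norm_hol_sub_one_le_pow_of_steps {W : LSite d → Fin d → 𝔸ˣ} {lo hi : LSite d} {γ : ℝ} (hγ : 0 ≤ γ)
    (hstep : ∀ (x : LSite d) (l : Letter d), InBox lo hi x → InBox lo hi (x + l.vec) → ‖((stepHol W x l : 𝔸ˣ) : 𝔸) - 1‖ ≤ γ) :
    ∀ (w : List (Letter d)) (x : LSite d), (∀ k, InBox lo hi (x + disp (w.take k))) →
      ‖((hol W x w : 𝔸ˣ) : 𝔸) - 1‖ ≤ (1 + γ) ^ w.length - 1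
  | [], x, _ => by simp
  | l :: w, x, hw => by
    have hx : InBox lo hi x := by simpa using hw 0
    have hxl : InBox lo hi (x + l.vec) := by simpa using hw 1
    have ih := norm_hol_sub_one_le_pow_of_steps hγ hstep w (x + l.vec) fun k => by
      have := hw (k + 1)
      simpa [add_assoc] using this
    rw [hol_cons, Units.val_mul, List.length_cons]
    exact norm_mul_sub_one_le_pow_growth hγ (hstep x l hx hxl) ih

/-- ★★★ **CLOSED WORDS NEAR `1` WITH GROWTH, FROM A GLOBAL PLAQUETTE HYPOTHESIS**: if `‖V(b)‖, ‖V(b)⁻¹‖ ≤ K` (`K ≥ 1`) and `‖V(∂p) − 1‖ ≤ α` for every plaquette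
contour of `ℤᵈ` (both orientations), then for every CLOSED word `w` from `y` whose positions stay in a box `[lo, hi] ∋ y` of `ℓ¹`-radius `≤ R` about `y`,
`‖V_y(w) − 1‖ ≤ (1 + γ)^{|w|} − 1`, `γ = K^{2R+1}·(K^{4R}·(R·K⁶α·(K²(1+K⁶α))^R))` — in the axial gauge `V₀` based at `y` (`V₀_y(w) = V_y(w)` for closed `w`) every
forward step of the walk is within `K^{4R}·R·α′·(K²(1+α′))^R` of `1` (★★) and every backward step costs a further `‖V₀(b)⁻¹‖ ≤ K^{2R+1}`. [cite: Balaban1985Averaging, pp.24-25] -/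
theorem norm_hol_closed_sub_one_le_of_radius_growth {V : LSite d → Fin d → 𝔸ˣ} {K : ℝ}
    (hK : ∀ x κ, ‖((V x κ : 𝔸ˣ) : 𝔸)‖ ≤ K ∧ ‖(((V x κ)⁻¹ : 𝔸ˣ) : 𝔸)‖ ≤ K) (hK1 : 1 ≤ K) {α : ℝ} (hα : 0 ≤ α)
    (h44 : ∀ (x : LSite d) (κ μ : Fin d), κ ≠ μ → ‖((hol V x (plaqWord κ μ) : 𝔸ˣ) : 𝔸) - 1‖ ≤ α)
    {lo hi : LSite d} (y : LSite d) {R : ℕ} (hR : ∀ x, InBox lo hi x → l1 (x - y) ≤ R)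
    (w : List (Letter d)) (hw : disp w = 0) (hwalk : ∀ k, InBox lo hi (y + disp (w.take k))) :
    ‖((hol V y w : 𝔸ˣ) : 𝔸) - 1‖ ≤
      (1 + K ^ (2 * R + 1) * (K ^ (4 * R) * (R * (K ^ 6 * α) * (K ^ 2 * (1 + K ^ 6 * α)) ^ R))) ^ w.length - 1 := by
  have hK0 : 0 ≤ K := zero_le_one.trans hK1
  set α' := K ^ 6 * α with hα'
  have hα'0 : 0 ≤ α' := mul_nonneg (pow_nonneg hK0 6) hα
  set M := K ^ 2 * (1 + α') with hM
  have hM1 : 1 ≤ M := by nlinarith [one_le_pow₀ (n := 2) hK1]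
  set γ₀ := K ^ (4 * R) * (R * α' * M ^ R) with hγ₀
  have hγ₀0 : 0 ≤ γ₀ := mul_nonneg (pow_nonneg hK0 _) (mul_nonneg (mul_nonneg (Nat.cast_nonneg _) hα'0) (pow_nonneg (zero_le_one.trans hM1) _))
  set V₀ := gaugeAct (axialFn V y) V with hV₀
  -- forward steps of the box
  have hfwd : ∀ x μ, InBox lo hi x → ‖((V₀ x μ : 𝔸ˣ) : 𝔸) - 1‖ ≤ γ₀ := fun x μ hx => by
    have h := axial_bond_bound_growth hK hK1 y hα h44 x μ
    rw [← hV₀] at h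
    refine h.trans ?_
    have hn := hR x hx
    have h1 : K ^ (4 * l1 (x - y)) ≤ K ^ (4 * R) := pow_le_pow_right₀ hK1 (by omega)
    have h2 : (l1 (x - y) : ℝ) ≤ R := by exact_mod_cast hn
    have h3 : M ^ l1 (x - y) ≤ M ^ R := pow_le_pow_right₀ hM1 hn
    have h4 : 0 ≤ M ^ l1 (x - y) := pow_nonneg (zero_le_one.trans hM1) _
    rw [hγ₀]; gcongr
  have hax : axialFn V y y = 1 := by simp [axialFn]
  have heq : hol V y w = hol V₀ y w := by rw [hV₀, hol_gaugeAct_closed _ _ _ _ hw, hax, one_mul, inv_one, mul_one]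
  rw [heq]
  refine norm_hol_sub_one_le_pow_of_steps (mul_nonneg (pow_nonneg hK0 _) hγ₀0) (fun x l hx hxl => ?_) w y hwalk
  obtain ⟨μ, b⟩ := l
  cases b
  · -- backward letter: `(V₀ (x - e μ) μ)⁻¹`, `x - e μ` and `x` in the box
    rw [stepHol_false]
    have hxm : InBox lo hi (x - e μ) := by simpa [sub_eq_add_neg] using hxl
    have hb := hfwd (x - e μ) μ hxm
    have hinv := norm_gaugeAct_axialFn_inv_le_growth hK hK1 y (x - e μ) μ
    rw [← hV₀, sub_add_cancel] at hinv
    have hexp : l1 (x - y) + 1 + l1 (x - e μ - y) ≤ 2 * R + 1 := by have := hR x hx; have := hR _ hxm; omega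
    set u := V₀ (x - e μ) μ with hu
    have h1 : ‖((u⁻¹ : 𝔸ˣ) : 𝔸) - 1‖ ≤ ‖((u⁻¹ : 𝔸ˣ) : 𝔸)‖ * ‖(u : 𝔸) - 1‖ := by
      rw [show ((u⁻¹ : 𝔸ˣ) : 𝔸) - 1 = ((u⁻¹ : 𝔸ˣ) : 𝔸) * (1 - (u : 𝔸)) by rw [mul_sub, mul_one, Units.inv_mul], ← norm_sub_rev (1 : 𝔸) (u : 𝔸)]
      exact norm_mul_le _ _
    exact h1.trans (mul_le_mul (hinv.trans (pow_le_pow_right₀ hK1 hexp)) hb (norm_nonneg _) (pow_nonneg hK0 _))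
  · rw [stepHol_true]
    refine (hfwd x μ hx).trans ?_
    have : (1 : ℝ) ≤ K ^ (2 * R + 1) := one_le_pow₀ hK1
    nlinarith

/-- The clamped extension of a configuration with `‖V(b)‖, ‖V(b)⁻¹‖ ≤ K` on the bonds of the box has the same bounds everywhere (`K ≥ 1`; its other bond variables are
`1`). [folklore] -/
theorem clampCfg_growth {V : LSite d → Fin d → 𝔸ˣ} {lo hi : LSite d} (hlohi : ∀ i, lo i ≤ hi i) {K : ℝ} (hK1 : 1 ≤ K)
    (hK : ∀ (x : LSite d) (κ : Fin d), InBox lo hi x → InBox lo hi (x + e κ) → ‖((V x κ : 𝔸ˣ) : 𝔸)‖ ≤ K ∧ ‖(((V x κ)⁻¹ : 𝔸ˣ) : 𝔸)‖ ≤ K)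
    (x : LSite d) (κ : Fin d) :
    ‖((clampCfg lo hi V x κ : 𝔸ˣ) : 𝔸)‖ ≤ K ∧ ‖(((clampCfg lo hi V x κ)⁻¹ : 𝔸ˣ) : 𝔸)‖ ≤ K := by
  unfold clampCfg; split_ifs with h
  · refine hK _ κ (clamp_inBox hlohi x) ?_
    rw [← clamp_add_e_of h]; exact clamp_inBox hlohi _
  · simpa using hK1

/-- ★★★ **CLOSED WORDS NEAR `1` WITH GROWTH, FROM THE BOX ONLY**: if `‖V(b)‖, ‖V(b)⁻¹‖ ≤ K` on the bonds of `[lo, hi]` (`K ≥ 1`) and `‖V(∂p) − 1‖ ≤ α` for every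
plaquette contour with all corners in `[lo, hi]` (`PlaqIn`, both orientations), then for every closed word `w` from `y` whose positions stay in `[lo, hi]`
(`ℓ¹`-radius `≤ R` about `y`), `‖V_y(w) − 1‖ ≤ (1 + γ)^{|w|} − 1` with the `γ` of ★★★ above — applied to the clamped extension `clampCfg lo hi V`
(`B7Prop1Local.norm_hol_plaqWord_clampCfg_le`, `hol_congr_of_inBox`). [cite: Balaban1985Averaging, (19)-(20) p.21 and pp.24-25] -/
theorem norm_hol_closed_sub_one_le_inBox_growth {V : LSite d → Fin d → 𝔸ˣ} {lo hi : LSite d} (hlohi : ∀ i, lo i ≤ hi i) {K : ℝ} (hK1 : 1 ≤ K)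
    (hK : ∀ (x : LSite d) (κ : Fin d), InBox lo hi x → InBox lo hi (x + e κ) → ‖((V x κ : 𝔸ˣ) : 𝔸)‖ ≤ K ∧ ‖(((V x κ)⁻¹ : 𝔸ˣ) : 𝔸)‖ ≤ K)
    {α : ℝ} (hα : 0 ≤ α)
    (h44 : ∀ (x : LSite d) (κ μ : Fin d), κ ≠ μ → PlaqIn lo hi (x, κ, μ) → ‖((hol V x (plaqWord κ μ) : 𝔸ˣ) : 𝔸) - 1‖ ≤ α)
    (y : LSite d) {R : ℕ} (hR : ∀ x, InBox lo hi x → l1 (x - y) ≤ R)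
    (w : List (Letter d)) (hw : disp w = 0) (hwalk : ∀ k, InBox lo hi (y + disp (w.take k))) :
    ‖((hol V y w : 𝔸ˣ) : 𝔸) - 1‖ ≤
      (1 + K ^ (2 * R + 1) * (K ^ (4 * R) * (R * (K ^ 6 * α) * (K ^ 2 * (1 + K ^ 6 * α)) ^ R))) ^ w.length - 1 := by
  set V' := clampCfg lo hi V with hV'
  have hK' : ∀ x κ, ‖((V' x κ : 𝔸ˣ) : 𝔸)‖ ≤ K ∧ ‖(((V' x κ)⁻¹ : 𝔸ˣ) : 𝔸)‖ ≤ K := clampCfg_growth hlohi hK1 hK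
  have h44' : ∀ (x : LSite d) (κ μ : Fin d), κ ≠ μ → ‖((hol V' x (plaqWord κ μ) : 𝔸ˣ) : 𝔸) - 1‖ ≤ α :=
    fun x κ μ hκμ => norm_hol_plaqWord_clampCfg_le hlohi V hκμ hα (fun x' hx' => h44 x' κ μ hκμ hx') x
  have heq : hol V y w = hol V' y w := (hol_congr_of_inBox (clampCfg_agree V) w y hwalk).symm
  rw [heq]
  exact norm_hol_closed_sub_one_le_of_radius_growth hK' hK1 hα h44' y hR w hw hwalk

end Closed

end YMDAG.N18.BoxStokes

end
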